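/-
Copyright (c) 2026 the pub-hodgecm-mathlib formalisation cell (harness21).  Prover seat hodgecm-mathlib-K2E3-p23 (g4), Track B «K2-LIT» ∕ h413
(`stmt-HodgeConjecture-24833`), line `K2_E3_EllipticInputs`, (SC-an) road «FC» (line lead K2E3-p14 (g4), RULINGS #15∕#18), brick (FC-8) file F3b — THE HEAD.  2026-09-04.
-/
import Summits.HodgeConjecture.HodgeConjecture.Theorems.K2E3FinConjOfBoxDecay               -- ★ (FC-8 F3a) p857295 (this seat): the generic assembly; brings ★ FC-8a, ★ F2, ★ FC-B, ★ FC-A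
import Summits.HodgeConjecture.HodgeConjecture.Theorems.K2E3RankOneUnitaryUnimodular        -- ★ p857293 (this seat): `U(σ,Φ₃)(K)` unimodular; brings ★ F1 (K₀, cover, boxes, entries)
import Summits.HodgeConjecture.HodgeConjecture.Theorems.K2E3BoxCompactCentralizerCollision   -- ★ (FC-6) p857247 (K2E3-p14 (g4)): compact centraliser in the box ⇒ near diagonal collision
import Summits.HodgeConjecture.HodgeConjecture.Theorems.K2E3TorusNearCollisionBound         -- ★ (FC-5c) p857278 (K2E2-p13 (g3)): `μ(B ∩ near-collision) ≤ C (ε∕ρ)^κ μ(B)` (over ★ FC-5, FC-5b, FC-D, FC-C)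
import Summits.HodgeConjecture.HodgeConjecture.Theorems.K2E3FinConjBoxTorusInvariant         -- ★ p857294 (K2E2-p13 (g3)): the box is `t_a`-invariant
import Summits.HodgeConjecture.HodgeConjecture.Theorems.K2E3GeometricTailSummable           -- ★ p857263 (K2E3-p14 (g4)): `tsum_lt_top_of_le_pow_of_linear`, `rpow_pow_comm`
import Summits.HodgeConjecture.HodgeConjecture.Theorems.K2E3SplitTorusTwistModuleBound      -- ★ p856900 (K2E3-p20 (g4)): `v_le_iff_normAbs_le`, `v_eq_iff_normAbs_eq`, `normAbs_map_eq`
import Literature.NumberTheory.Automorphic.TateLocalZetaShells                              -- ★ `secondCountableTopology_units`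
import Literature.NumberTheory.Automorphic.ValuedFieldValuativeRelBridge                    -- ★ `valuedInteger_eq_integer`
import HarnessLib

/-!
# Crux `H413` — K2-LIT E3, (SC-an) road «FC», brick (FC-8) file F3b: **(FC) ON THE MODEL `U(σ, Φ₃)(K)`** — for every compact `C ⊆ U` and every continuous
# compactly supported `β ≤ M_b < ∞`: `∫_{C ∩ Φ_β} ∫_U β(x g x⁻¹) dμ(x) dμ(g) < ∞`, `Φ_β = {g | ∫_U β(x g x⁻¹) dμ(x) < ∞}` (the `hFC` binder of ★ FC-9)

Cell `hodgecm-mathlib`, Track B, line `K2_E3_EllipticInputs`, socket U12 :255 (SC-an) via road «FC» of K2E3-p14 (g4) (RULINGS #15 (R15-1), #18 (R18-1) «FC-8 the model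
assembly is yours by name: `Theorems/K2E3FinConjRankOne.lean :: finConj`»); seat K2E3-p23 (g4).  THEOREMS ONLY (no `def`, no `instance`, no notation, no named-fact
hypothesis, no `sorry`); count-neutral helper (`--supports stmt-HodgeConjecture-24833 --as helper`).  Consumer: ★ (FC-9) p857240 `K2E3EllWeightPlaceOfFinConj.
ellWeightPlace_of_finConj(Place)` (K2E5-p04 (g3)), whose `hFC` binder is this head at `K = L_w`, `σ = galAdicCompletionMap`, after which ★ (M5h‴) pays (SC-an) at `N = 3`.

THE ASSEMBLY (R15-1).  `K₀ = U ∩ GL₃(𝒪)` (★ F1), ray `a = d(ϖ,1,(σϖ)⁻¹)`, `tₙ = (aⁿ)⁻¹`, `U = ⋃ₙ K₀ tₙ K₀` (★ F1 `exists_mem_doubleCoset_inv_pow`), `Ω = K₀ (C ∪ tsupport β) K₀`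
(compact, `K₀`-bi-invariant, `⊆ ⋃_{f ∈ F} f K₀`, entries `≤ exp M` — ★ F1 §4), `μ` right invariant (★ `K2E3RankOneUnitaryUnimodular`).  By ★ F3a
`lintegral_fibre_lt_top_of_boxDecay` it suffices to give `εₙ` with `Σ εₙ < ∞` and `μ(boxₙ ∩ Zc) ≤ μ(boxₙ) εₙ` (`boxₙ = Ω ∩ {h | tₙ h tₙ⁻¹ ∈ Ω}`).  For `n ≥ 5M + 3`, with
`k = ⌊(n − 5M − 2)∕4⌋`: `h ∈ boxₙ` has all entries `≤ exp M`, upper entries `≤ exp(M − n)`, `exp(M − 2n)` (★ F1 `v_upper_le_of_conj_inv_pow`), hence `|h₀₀|, |h₁₁| ≥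
q^{−2M} =: ρ` (★ F2 `exp_neg_le_v_diag_of_upper_small`), and if `Z(h)` is compact then `|hᵢᵢ − hⱼⱼ| < q^{−k}` for some `i ≠ j` (★ FC-6); `boxₙ` is measurable and `t_a`-invariant
(★ `torusOne_smul_box_eq`), so ★ FC-5c gives `μ(boxₙ ∩ Zc) ≤ μ(boxₙ ∩ {near-collision at q^{−k}}) ≤ C_* (q^{−k}∕ρ)^κ μ(boxₙ)`; for `n < 5M + 3` take `εₙ = 1`.  The tail
`C_* ρ^{−κ} (q^{−κ})^{k(n)}` with `n ≤ 4 k(n) + 5M + 5` sums (★ `tsum_lt_top_of_le_pow_of_linear`).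
* `decay_const_eq` — the algebra `C_* · ((q^{−k}∕ρ))^κ = B · r^k`; **`finConj`** — THE HEAD.

HONEST LABEL: HC_CM is proved only modulo the 7 printed citations (2 remaining named inputs: hLiu418 = stmt-HodgeConjecture-24832, h413 =
stmt-HodgeConjecture-24833) until rung 0 closes; (SC-an) is NOT ★ by this file alone — it becomes ★ only after FC-9's instantiation at the place and the dealer's U12
re-point; nothing here is a named fact.

## References
* [HarishChandra1970] Harish-Chandra (notes by G. van Dijk), *Harmonic Analysis on Reductive p-adic Groups*, LNM 162 (1970), Part V §3, Part VI §8 Theorem 14 p. 60,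
  Part VII §2 p. 69 (the `L¹_loc`-ness of `|D|^{−1∕2}` via `K A K` and the near-singular boxes — here in the weaker `L²`-form (FC) that needs no germs).
* [Rogawski1990] J. D. Rogawski, *Automorphic Representations of Unitary Groups in Three Variables*, Ann. of Math. Stud. 123 (1990), §1.9–§1.10 pp. 8–9, §7.3 p. 97.
* [BruhatTits1972] F. Bruhat, J. Tits, *Groupes réductifs sur un corps local I*, Publ. Math. IHÉS 41 (1972), (4.4.3).
* [Cartier1979] P. Cartier, *Representations of p-adic groups: a survey*, Proc. Sympos. Pure Math. 33.1 (1979), §I.3–I.4.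
-/

set_option autoImplicit false
-- the mandated namespace repeats `HodgeConjecture.HodgeConjecture`, as in every `Theorems/*.lean` of this sub-problem
set_option linter.dupNamespace false

noncomputable section

open MeasureTheory MeasureTheory.Measure Set ValuativeRel
open scoped ENNReal NNReal Pointwise MatrixGroups WithZero Valued

namespace Summit.HodgeConjecture.HodgeConjecture.Cruxes.H413.K2E3FinConjRankOne

open Literature.NumberTheory.Automorphic Literature.NumberTheory.Automorphic.UnitaryGroup Literature.NumberTheory.Automorphic.HermitianLattice
open Literature.NumberTheory.GaloisRepresentations Literature.NumberTheory.GaloisRepresentations.IsNonarchimedeanLocalField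
open K2E3FinConjCartanCover K2E3FinConjFibreReduction K2E3FinConjOfBoxDecay K2E3GeometricTailSummable K2E3SplitTorusTwistModuleBound
open K2E3DiagonalCollisionMeasure

/-! ## §1 The decay constants -/

/-- **The algebra of the tail**: `C · ((x^k ∕ ρ))^κ = (C · (ρ⁻¹)^κ) · (x^κ)^k` in `ℝ≥0∞` for `x, ρ : ℝ≥0`, `κ ≥ 0` (★ `rpow_pow_comm`). [folklore] -/
theorem decay_const_eq (C : ℝ≥0∞) (x ρ : ℝ≥0) {κ : ℝ} (hκ : 0 ≤ κ) (k : ℕ) :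
    C * (((x ^ k / ρ : ℝ≥0)) : ℝ≥0∞) ^ κ = C * (((ρ⁻¹ : ℝ≥0)) : ℝ≥0∞) ^ κ * (((x : ℝ≥0∞)) ^ κ) ^ k := by
  rw [div_eq_mul_inv, ENNReal.coe_mul, ENNReal.mul_rpow_of_nonneg _ _ hκ, ENNReal.coe_pow, rpow_pow_comm, mul_comm ((((x : ℝ≥0∞)) ^ κ) ^ k), mul_assoc]

/-! ## §2 THE HEAD: (FC) on `U(σ, Φ₃)(K)` -/

/-- **(FC) — THE FINITE CONJUGATION MEASURE ON `U(σ, Φ₃)(K)`.**  `K` a non-archimedean local field of characteristic zero (`Valued` + compatible `ValuativeRel`), `σ` an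
isometric involution, `ϖ` a uniformiser, `J = Φ₃`, `μ` ANY Haar measure on `U = U(σ, J)(K)` (second countable, locally compact): for every compact `C ⊆ U` and every
continuous `β : U → [0, ∞]` with compact topological support and `β ≤ M_b < ∞`,
`∫⁻_{g ∈ C ∩ {g | ∫⁻ β(x g x⁻¹) dμ(x) < ⊤}} ∫⁻ β(x g x⁻¹) dμ(x) dμ(g) < ⊤` — the `hFC` binder of ★ (FC-9) `ellWeightPlace_of_finConj`, i.e. road «FC»'s replacement of
Harish-Chandra's Theorem 14 for the compact Cartan subgroups of `U(3)`. Assembly of ★ F1, F2, F3a (this seat), ★ FC-A (K2E5-p01), ★ FC-B (K2E3-p11), ★ FC-C (this seat), ★ FC-5∕5b∕5c +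
box-torus brick (K2E2-p13), ★ FC-D (K2E3-p21), ★ FC-6∕6b + tail lemma (K2E3-p14), ★ FC-6a∕FC-H (K2E5-p01).
[cite: HarishChandra1970, Part VI §8 Theorem 14 p. 60; Part VII §2 p. 69] [cite: Rogawski1990, §7.3 p. 97] [cite: BruhatTits1972, (4.4.3)] [cite: Cartier1979, §I.3–I.4] -/
theorem finConj {K : Type*} [Field K] [Valued K ℤᵐ⁰] [ValuativeRel K] [(Valued.v : Valuation K ℤᵐ⁰).Compatible] [IsNonarchimedeanLocalField K] [CharZero K]
    (σ : K →+* K) (hσ : ∀ x, σ (σ x) = x) (hσv : ∀ x, Valued.v (σ x) = Valued.v x) {ϖ : K} (hϖ : Valued.v ϖ = WithZero.exp (-1 : ℤ))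
    {J : Matrix (Fin 3) (Fin 3) K} (hJ : J = (StdForm.antidiagonal 3).over K)
    [MeasurableSpace ↥(unitaryGroupOfForm σ J)] [BorelSpace ↥(unitaryGroupOfForm σ J)]
    [SecondCountableTopology ↥(unitaryGroupOfForm σ J)] [LocallyCompactSpace ↥(unitaryGroupOfForm σ J)]
    (μ : Measure ↥(unitaryGroupOfForm σ J)) [μ.IsHaarMeasure]
    {C : Set ↥(unitaryGroupOfForm σ J)} (hC : IsCompact C) {β : ↥(unitaryGroupOfForm σ J) → ℝ≥0∞} (hβ : Continuous β) (hβs : IsCompact (tsupport β))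
    {Mb : ℝ≥0∞} (hMb : Mb ≠ ⊤) (hβM : ∀ g, β g ≤ Mb) :
    ∫⁻ g in C ∩ {g : ↥(unitaryGroupOfForm σ J) | ∫⁻ x, β (x * g * x⁻¹) ∂μ < ⊤}, ∫⁻ x, β (x * g * x⁻¹) ∂μ ∂μ < ⊤ := by
  subst hJ
  -- §0 frame facts
  have h2 : (2 : K) ≠ 0 := two_ne_zero
  have h3 : (3 : K) ≠ 0 := three_ne_zero
  have hϖ0 : ϖ ≠ 0 := fun h => by rw [h, map_zero] at hϖ; exact WithZero.zero_ne_coe hϖ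
  haveI : CompactSpace (Valued.integer K) := by rw [valuedInteger_eq_integer]; infer_instance
  haveI : μ.IsMulRightInvariant := K2E3RankOneUnitaryUnimodular.isMulRightInvariant_of_isHaarMeasure σ rfl hσ hσv hϖ h2 h3 μ
  have hσn : ∀ x, normAbs K (σ x) = normAbs K x := normAbs_map_eq σ hσv
  -- §1 `K₀`, the ray, the cover
  have hKo : IsOpen (unitaryInt σ ((StdForm.antidiagonal 3).over K) : Set ↥(unitaryGroupOfForm σ ((StdForm.antidiagonal 3).over K))) := isOpen_unitaryInt σ _
  have hKc : IsCompact (unitaryInt σ ((StdForm.antidiagonal 3).over K) : Set ↥(unitaryGroupOfForm σ ((StdForm.antidiagonal 3).over K))) :=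
    isCompact_unitaryInt_of_forall_v_eq hσv _
  obtain ⟨a, ha⟩ := exists_coe_eq_diagonal_uniformizer σ (J := (StdForm.antidiagonal 3).over K) rfl hσ hϖ0
  have hcov := exists_mem_doubleCoset_inv_pow σ (J := (StdForm.antidiagonal 3).over K) rfl hσ hσv hϖ h2 h3 a ha
  -- §2 the box `Ω = K₀ (C ∪ tsupport β) K₀`
  set S₀ : Set ↥(unitaryGroupOfForm σ ((StdForm.antidiagonal 3).over K)) := C ∪ tsupport β with hS₀
  have hS₀c : IsCompact S₀ := hC.union hβs
  set Ω : Set ↥(unitaryGroupOfForm σ ((StdForm.antidiagonal 3).over K)) :=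
    (unitaryInt σ ((StdForm.antidiagonal 3).over K) : Set ↥(unitaryGroupOfForm σ ((StdForm.antidiagonal 3).over K))) * S₀ *
      (unitaryInt σ ((StdForm.antidiagonal 3).over K) : Set ↥(unitaryGroupOfForm σ ((StdForm.antidiagonal 3).over K))) with hΩ
  have hΩc : IsCompact Ω := isCompact_box _ hKc hS₀c
  have hΩm : MeasurableSet Ω := hΩc.isClosed.measurableSet
  have hCΩ : C ⊆ Ω := (Set.subset_union_left).trans (subset_box _ S₀)
  have hβΩ : ∀ g, β g ≠ 0 → g ∈ Ω := fun g hg => subset_box _ S₀ (Set.subset_union_right (subset_tsupport β hg))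
  have hΩl : ∀ k ∈ unitaryInt σ ((StdForm.antidiagonal 3).over K), ∀ g, k * g ∈ Ω ↔ g ∈ Ω := fun k hk g => mul_mem_box_iff _ S₀ hk g
  have hΩr : ∀ k ∈ unitaryInt σ ((StdForm.antidiagonal 3).over K), ∀ g, g * k ∈ Ω ↔ g ∈ Ω := fun k hk g => mem_box_mul_iff _ S₀ hk g
  obtain ⟨F, hΩF⟩ := exists_finset_subset_biUnion_smul (unitaryInt σ ((StdForm.antidiagonal 3).over K)) hKo hΩc
  obtain ⟨M, hM⟩ := exists_forall_mem_v_apply_le_exp σ ((StdForm.antidiagonal 3).over K) hϖ hΩc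
  -- §3 a Haar measure on `Kˣ` and the (FC-5c) constants
  letI : MeasurableSpace Kˣ := borel Kˣ
  haveI : BorelSpace Kˣ := ⟨rfl⟩
  haveI : SecondCountableTopology Kˣ := secondCountableTopology_units K
  obtain ⟨κ, hκ, Cst, hCst, h5⟩ := K2E3TorusNearCollisionBound.measure_inter_nearCollision_le σ hσ hσn (Measure.haar : Measure Kˣ) μ
  -- §4 radii `x = |ϖ|`, `ρ = |ϖ|^{2M}`, ratio `r = |ϖ|^κ`, constant `B`, threshold `n₀`, depth `k(n)` and the decay sequence `ε`
  set x : ℝ≥0 := normAbs K ϖ with hx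
  have hx0 : x ≠ 0 := (map_ne_zero (normAbs K)).2 hϖ0
  have hx1 : x < 1 := by
    have hv : Valued.v ϖ < Valued.v (1 : K) := by
      rw [hϖ, map_one, ← WithZero.exp_zero]; exact WithZero.exp_lt_exp.2 (by norm_num)
    have hle : normAbs K ϖ ≤ normAbs K 1 := (v_le_iff_normAbs_le _ _).1 hv.le
    have hne : normAbs K ϖ ≠ normAbs K 1 := fun h => hv.ne ((v_eq_iff_normAbs_eq _ _).2 h)
    rw [map_one] at hle hne
    exact lt_of_le_of_ne hle hne
  set ρ : ℝ≥0 := normAbs K (ϖ ^ (2 * M)) with hρ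
  have hρ0 : ρ ≠ 0 := (map_ne_zero (normAbs K)).2 (pow_ne_zero _ hϖ0)
  have hρpos : 0 < ρ := pos_iff_ne_zero.2 hρ0
  set r : ℝ≥0∞ := ((x : ℝ≥0) : ℝ≥0∞) ^ κ with hr
  have hr1 : r < 1 := ENNReal.rpow_lt_one (by exact_mod_cast hx1) hκ
  have hr0 : r ≠ 0 := (ENNReal.rpow_pos (by exact_mod_cast pos_iff_ne_zero.2 hx0) ENNReal.coe_ne_top).ne'
  set B : ℝ≥0∞ := Cst * (((ρ⁻¹ : ℝ≥0)) : ℝ≥0∞) ^ κ with hB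
  have hBT : B ≠ ⊤ := ENNReal.mul_ne_top hCst (ENNReal.rpow_ne_top_of_nonneg hκ.le ENNReal.coe_ne_top)
  set n₀ : ℕ := 5 * M + 3 with hn₀
  set kf : ℕ → ℕ := fun n => (n - (5 * M + 2)) / 4 with hkf
  set ε : ℕ → ℝ≥0∞ := fun n => if n < n₀ then 1 else Cst * (((x ^ kf n / ρ : ℝ≥0)) : ℝ≥0∞) ^ κ with hε
  have hεeq : ∀ n, n₀ ≤ n → ε n = B * r ^ kf n := fun n hn => by
    simp only [hε, if_neg (not_lt.2 hn)]
    exact decay_const_eq Cst x ρ hκ.le (kf n)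
  have hεT : ∀ n, ε n ≠ ⊤ := fun n => by
    by_cases hn : n < n₀
    · simp only [hε, if_pos hn]; exact ENNReal.one_ne_top
    · rw [hεeq n (not_lt.1 hn)]; exact ENNReal.mul_ne_top hBT (ENNReal.pow_ne_top (hr1.trans ENNReal.one_lt_top).ne)
  have hεsum : ∑' n, ε n ≠ ⊤ :=
    (tsum_lt_top_of_le_pow_of_linear hεT hBT hr0 hr1 (n₀ := n₀) (c := 5 * M + 5) (k := kf)
      (fun n hn => by simp only [hkf, hn₀] at hn ⊢; omega) (fun n hn => (hεeq n hn).le)).ne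
  -- §5 the decay on each box
  have hvρ : Valued.v (ϖ ^ (2 * M)) = WithZero.exp (-(2 * (M : ℤ))) := by
    rw [map_pow, hϖ, ← WithZero.exp_nsmul, nsmul_eq_mul]; push_cast; ring_nf
  have hdecay : ∀ n, μ (Ω ∩ {h : ↥(unitaryGroupOfForm σ ((StdForm.antidiagonal 3).over K)) | (a ^ n)⁻¹ * h * ((a ^ n)⁻¹)⁻¹ ∈ Ω} ∩
      {h : ↥(unitaryGroupOfForm σ ((StdForm.antidiagonal 3).over K)) |
        IsCompact ((Subgroup.centralizer ({h} : Set ↥(unitaryGroupOfForm σ ((StdForm.antidiagonal 3).over K)))) :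
          Set ↥(unitaryGroupOfForm σ ((StdForm.antidiagonal 3).over K)))}) ≤
      μ (Ω ∩ {h : ↥(unitaryGroupOfForm σ ((StdForm.antidiagonal 3).over K)) | (a ^ n)⁻¹ * h * ((a ^ n)⁻¹)⁻¹ ∈ Ω}) * ε n := by
    intro n
    by_cases hn : n < n₀
    · simp only [hε, if_pos hn, mul_one]; exact measure_mono Set.inter_subset_left
    rw [not_lt] at hn
    simp only [hε, if_neg (not_lt.2 hn)]
    set box : Set ↥(unitaryGroupOfForm σ ((StdForm.antidiagonal 3).over K)) :=
      Ω ∩ {h : ↥(unitaryGroupOfForm σ ((StdForm.antidiagonal 3).over K)) | (a ^ n)⁻¹ * h * ((a ^ n)⁻¹)⁻¹ ∈ Ω} with hbox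
    have hk : 5 * M + 4 * kf n + 2 ≤ n := by simp only [hkf, hn₀] at hn ⊢; omega
    have hn3 : 3 * M < n := by simp only [hn₀] at hn; omega
    -- entries on the box: all `≤ exp M`, upper ones small
    have hfacts : ∀ h ∈ box, (∀ i j, Valued.v (((h : GL (Fin 3) K) : Matrix (Fin 3) (Fin 3) K) i j) ≤ WithZero.exp (M : ℤ)) ∧
        Valued.v (((h : GL (Fin 3) K) : Matrix (Fin 3) (Fin 3) K) 0 1) ≤ WithZero.exp ((M : ℤ) - n) ∧
        Valued.v (((h : GL (Fin 3) K) : Matrix (Fin 3) (Fin 3) K) 1 2) ≤ WithZero.exp ((M : ℤ) - n) ∧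
        Valued.v (((h : GL (Fin 3) K) : Matrix (Fin 3) (Fin 3) K) 0 2) ≤ WithZero.exp ((M : ℤ) - 2 * n) := by
      intro h hh
      have hconj : (a ^ n)⁻¹ * h * a ^ n ∈ Ω := by
        have h' := hh.2
        rwa [Set.mem_setOf_eq, inv_inv] at h'
      exact ⟨hM h hh.1, v_upper_le_of_conj_inv_pow σ rfl hσ hσv hϖ a ha n M h (fun i j => hM _ hconj i j)⟩
    -- the box is measurable and torus invariant; the diagonal is bounded below by `ρ` on it
    have hboxm : MeasurableSet box :=
      hΩm.inter (hΩc.isClosed.preimage ((continuous_const.mul continuous_id).mul continuous_const)).measurableSet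
    have htorus : ∀ a' : Kˣ, valuation K (a' : K) = 1 →
        (⟨glDiagonal 3 K ![a', 1, (Units.map (σ : K →* K) a')⁻¹], torusOne_mem_unitaryGroupOfForm σ hσ a'⟩ :
          ↥(unitaryGroupOfForm σ ((StdForm.antidiagonal 3).over K))) • box = box := fun a' ha' =>
      K2E3FinConjBoxTorusInvariant.torusOne_smul_box_eq σ hσ hσv S₀ ((a ^ n)⁻¹) _ (coe_inv_pow_eq_diagonal σ rfl hσ a ha n) a' ha'
    have hlow : ∀ g ∈ box, ρ ≤ normAbs K (((g : GL (Fin 3) K) : Matrix (Fin 3) (Fin 3) K) 0 0) ∧ ρ ≤ normAbs K (((g : GL (Fin 3) K) : Matrix (Fin 3) (Fin 3) K) 1 1) := by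
      intro g hg
      obtain ⟨hall, h01, h12, h02⟩ := hfacts g hg
      have key : ∀ i, ρ ≤ normAbs K (((g : GL (Fin 3) K) : Matrix (Fin 3) (Fin 3) K) i i) := fun i => by
        have hi := exp_neg_le_v_diag_of_upper_small σ rfl hσv hn3 g hall h01 h12 h02 i
        rw [← hvρ] at hi
        exact (v_le_iff_normAbs_le _ _).1 hi
      exact ⟨key 0, key 1⟩
    -- ★ (FC-6): compact centraliser in the box ⇒ near diagonal collision at scale `|ϖ|^k`
    have hvk : Valued.v (ϖ ^ kf n) = WithZero.exp (-(kf n : ℤ)) := by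
      rw [map_pow, hϖ, ← WithZero.exp_nsmul, nsmul_eq_mul, mul_neg_one]
    have hsub : box ∩ {h : ↥(unitaryGroupOfForm σ ((StdForm.antidiagonal 3).over K)) |
        IsCompact ((Subgroup.centralizer ({h} : Set ↥(unitaryGroupOfForm σ ((StdForm.antidiagonal 3).over K)))) :
          Set ↥(unitaryGroupOfForm σ ((StdForm.antidiagonal 3).over K)))} ⊆
        box ∩ {g : ↥(unitaryGroupOfForm σ ((StdForm.antidiagonal 3).over K)) | ∃ i j : Fin 3, i ≠ j ∧
          normAbs K (((g : GL (Fin 3) K) : Matrix (Fin 3) (Fin 3) K) i i - ((g : GL (Fin 3) K) : Matrix (Fin 3) (Fin 3) K) j j) ≤ x ^ kf n} := by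
      rintro h ⟨hh, hZ⟩
      refine ⟨hh, ?_⟩
      obtain ⟨hall, h01, h12, h02⟩ := hfacts h hh
      obtain ⟨i, j, hij, hv⟩ :=
        K2E3BoxCompactCentralizerCollision.exists_v_sub_lt_of_isCompact_centralizer σ hσ hσv hϖ rfl hk h hall h01 h12 h02 hZ
      refine ⟨i, j, hij, ?_⟩
      have hle : Valued.v (((h : GL (Fin 3) K) : Matrix (Fin 3) (Fin 3) K) i i - ((h : GL (Fin 3) K) : Matrix (Fin 3) (Fin 3) K) j j) ≤
          Valued.v (ϖ ^ kf n) := by rw [hvk]; exact hv.le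
      have hn' := (v_le_iff_normAbs_le _ _).1 hle
      rwa [map_pow] at hn'
    calc μ (box ∩ {h : ↥(unitaryGroupOfForm σ ((StdForm.antidiagonal 3).over K)) |
            IsCompact ((Subgroup.centralizer ({h} : Set ↥(unitaryGroupOfForm σ ((StdForm.antidiagonal 3).over K)))) :
              Set ↥(unitaryGroupOfForm σ ((StdForm.antidiagonal 3).over K)))})
        ≤ μ (box ∩ {g : ↥(unitaryGroupOfForm σ ((StdForm.antidiagonal 3).over K)) | ∃ i j : Fin 3, i ≠ j ∧
            normAbs K (((g : GL (Fin 3) K) : Matrix (Fin 3) (Fin 3) K) i i - ((g : GL (Fin 3) K) : Matrix (Fin 3) (Fin 3) K) j j) ≤ x ^ kf n}) :=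
          measure_mono hsub
      _ ≤ Cst * (((x ^ kf n / ρ : ℝ≥0)) : ℝ≥0∞) ^ κ * μ box := h5 ρ hρpos (x ^ kf n) box hboxm htorus hlow
      _ = μ box * (Cst * (((x ^ kf n / ρ : ℝ≥0)) : ℝ≥0∞) ^ κ) := by rw [mul_comm]
  -- §6 the generic assembly ★ F3a
  exact lintegral_fibre_lt_top_of_boxDecay μ (unitaryInt σ ((StdForm.antidiagonal 3).over K)) hKo hKc (fun n => (a ^ n)⁻¹) hcov Ω hΩl hΩr F hΩF hCΩ
    hβ hβΩ hMb hβM ε hεsum hdecay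

end Summit.HodgeConjecture.HodgeConjecture.Cruxes.H413.K2E3FinConjRankOne

end
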